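import Literature.AlgebraicGeometry.Resolution.QuadraticTransformWeakTransform
import Literature.AlgebraicGeometry.Resolution.QuadraticTransformsTree
import Literature.AlgebraicGeometry.Resolution.FlatSlicingCriterion
import Mathlib.Data.Fintype.EquivFin
import HarnessLib

/-!
# Finiteness of the base tree (Zariski: a linear system on a regular two-dimensional local
# scheme has finitely many base points, infinitely near ones included)

Topic: `Literature/AlgebraicGeometry/Resolution`. Zariski–Samuel II, Appendix 5 (and Zariski 1944):
for a two-dimensional regular local ring `(R, 𝔪)` of the field `K = Frac R` and a non-zero vector
`w ∈ Kⁿ⁺¹`, the set `baseTree R w` (`QuadraticTransformsTree.lean`) of iterated quadratic transforms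
of `R` at which `(w₀ : … : wₙ)` is not defined is FINITE: the indeterminacy of a rational map from
the tower of point blowing ups of `Spec R` to `ℙⁿ` is resolved after finitely many steps.
The proof is the classical principalization by point blowing ups, counted with Huneke–Swanson's
Lemma 14.3.4: clearing denominators, `w` is defined on a local ring `𝔬 ⊇ R` iff the ideal
`J = (cw₀, …, cwₙ)` becomes principal in `𝔬` (`definedOn_iff_isPrincipal_extIdeal`); after
removing the greatest common divisor (`exists_eq_span_singleton_mul_forall_not_le`) `J` is
`𝔪`-primary; only finitely many first quadratic transforms `R₁` fail to principalize `J`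
(`finite_setOf_isQuadraticTransform_not_isPrincipal`), each is again a two-dimensional regular
local ring with infinite residue field, and at each of them, for a GENERIC chart parameter
`x = u + tv` (`InitialFormLinearFactors.lean`), the weak transform `J₁ = (JR₁ : x^r)` has smaller
colength than `J` (`length_quotient_weakTransform_map_lt`) and the same principality behaviour above
`R₁`; induction on the colength. PROVED: `finite_baseTree` (infinite residue field assumed — the
case of the local rings at curves of algebraic threefolds).

## References

* O. Zariski, P. Samuel, *Commutative Algebra* II (1960), Appendix 5. [ZariskiSamuel1960]
* C. Huneke, I. Swanson, *Integral Closure of Ideals, Rings, and Modules* (2006), Lemma 14.3.4.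
  [HunekeSwanson2006]
* O. Piltant, RACSAM 107 (2013), proof of Prop. 5.1, Lemma 5.6 (the count `N_η`). [Piltant2013]
-/

noncomputable section

open IsLocalRing Polynomial

namespace Literature.AlgebraicGeometry.Resolution

universe u

variable {K : Type u} [Field K]

/-! ## Clearing denominators: definedness versus principality -/

section Coords

variable {R : Subring K} {n : ℕ}

/-- A common denominator for finitely many elements of `K = Frac R`. [folklore] -/
theorem exists_forall_mul_mem (hRK : IsLocalRingOf R) (w : Fin (n + 1) → K) :
    ∃ c : R, (c : K) ≠ 0 ∧ ∀ l, (c : K) * w l ∈ R := by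
  classical
  choose a ha b hb hb0 hw using fun l => hRK.2 (w l)
  refine ⟨∏ l, (⟨b l, hb l⟩ : R), ?_, fun l => ?_⟩
  · rw [SubmonoidClass.coe_finsetProd]
    exact Finset.prod_ne_zero_iff.mpr fun l _ => hb0 l
  · rw [SubmonoidClass.coe_finsetProd, ← Finset.prod_erase_mul _ _ (Finset.mem_univ l), hw l]
    change (∏ x ∈ Finset.univ.erase l, b x) * b l * (a l / b l) ∈ R
    rw [mul_assoc, mul_div_cancel₀ _ (hb0 l)]
    exact R.mul_mem (prod_mem fun i _ => hb i) (ha l)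

/-- The ideal `(c w₀, …, c wₙ)` of `R`. [cite: ZariskiSamuel1960, Appendix 5] -/
def coordIdeal (w : Fin (n + 1) → K) (c : R) (hc : ∀ l, (c : K) * w l ∈ R) : Ideal R :=
  Ideal.span (Set.range fun l => (⟨(c : K) * w l, hc l⟩ : R))

/-- The extension of `(c w₀, …, c wₙ)` to `R' ⊇ R` is generated by the same elements. [folklore] -/
theorem extIdeal_coordIdeal (w : Fin (n + 1) → K) (c : R) (hc : ∀ l, (c : K) * w l ∈ R)
    {R' : Subring K} (h : R ≤ R') :
    extIdeal (coordIdeal w c hc) R' = Ideal.span (Set.range fun l => (⟨(c : K) * w l, h (hc l)⟩ : R')) := by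
  rw [extIdeal_eq_map _ h, coordIdeal, Ideal.map_span, ← Set.range_comp]
  rfl

/-- **`w` is defined on the local ring `𝔬 ⊇ R` iff `(c w₀, …, c wₙ)𝔬` is principal** (a finitely
generated fractional ideal of a local domain is principal iff it is generated by one of its given
generators). [cite: ZariskiSamuel1960, Appendix 5] -/
theorem definedOn_iff_isPrincipal_extIdeal (w : Fin (n + 1) → K) (hw : ∃ i, w i ≠ 0) (c : R)
    (hc0 : (c : K) ≠ 0) (hc : ∀ l, (c : K) * w l ∈ R) {R' : Subring K} [IsLocalRing R']
    (h : R ≤ R') : DefinedOn w R' ↔ (extIdeal (coordIdeal w c hc) R').IsPrincipal := by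
  rw [extIdeal_coordIdeal w c hc h]
  set g : Fin (n + 1) → R' := fun l => ⟨(c : K) * w l, h (hc l)⟩ with hgdef
  have hg : ∀ l, ((g l : R') : K) = (c : K) * w l := fun l => rfl
  constructor
  · rintro ⟨i, hi, hli⟩
    refine ⟨⟨g i, le_antisymm ?_ (Ideal.span_mono (Set.singleton_subset_iff.mpr ⟨i, rfl⟩))⟩⟩
    rw [Ideal.submodule_span_eq, Ideal.span_le]
    rintro _ ⟨l, rfl⟩
    rw [SetLike.mem_coe, Ideal.mem_span_singleton']
    refine ⟨⟨w l / w i, hli l⟩, Subtype.ext ?_⟩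
    change w l / w i * ((c : K) * w i) = (c : K) * w l
    field_simp
  · rintro ⟨d, hd⟩
    rw [Ideal.submodule_span_eq] at hd
    -- `g l = u l * d`
    have hmem : ∀ l, g l ∈ Ideal.span {d} := fun l => hd ▸ Ideal.subset_span ⟨l, rfl⟩
    choose u hu using fun l => Ideal.mem_span_singleton'.mp (hmem l)
    -- `d = Σ a l * g l`
    have hdmem : d ∈ Ideal.span (Set.range g) := hd ▸ Ideal.mem_span_singleton_self d
    obtain ⟨a, ha⟩ := Ideal.mem_span_range_iff_exists_fun.mp hdmem
    -- `d ≠ 0`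
    obtain ⟨i, hi⟩ := hw
    have hd0 : d ≠ 0 := by
      intro h0
      have : g i = 0 := by simpa [h0] using hmem i
      have h1 : (c : K) * w i = 0 := by rw [← hg i, this]; rfl
      exact (mul_ne_zero hc0 hi) h1
    -- `Σ a l * u l = 1`, so some `u j` is a unit
    have hsum : ∑ l, a l * u l = 1 := by
      apply mul_right_cancel₀ hd0
      rw [one_mul, Finset.sum_mul]
      conv_rhs => rw [← ha]
      refine Finset.sum_congr rfl fun l _ => ?_
      rw [mul_assoc, hu l]
    have hunit : ∃ j, IsUnit (u j) := by
      by_contra hcon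
      push Not at hcon
      have h1 : ∑ l, a l * u l ∈ maximalIdeal R' :=
        Ideal.sum_mem _ fun l _ => Ideal.mul_mem_left _ _ ((mem_maximalIdeal _).mpr (hcon l))
      rw [hsum] at h1
      exact (maximalIdeal.isMaximal R').ne_top (Ideal.eq_top_of_isUnit_mem _ h1 isUnit_one)
    obtain ⟨j, hj⟩ := hunit
    obtain ⟨hj0, hjinv⟩ := (isUnit_subring_iff_inv_mem _).mp hj
    have hgj : ((g j : R') : K) = (u j : K) * d := by rw [← hu j]; rfl
    have hwj : w j ≠ 0 := by
      intro h0
      have : ((g j : R') : K) = 0 := by rw [hg, h0, mul_zero]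
      rw [hgj] at this
      exact (mul_ne_zero hj0 (fun e => hd0 (Subtype.ext e))) this
    refine ⟨j, hwj, fun l => ?_⟩
    have e : w l / w j = (u l : K) * ((u j : R') : K)⁻¹ := by
      have hgl : ((g l : R') : K) = (u l : K) * d := by rw [← hu l]; rfl
      rw [hg] at hgl hgj
      have hd0K : ((d : R') : K) ≠ 0 := fun e => hd0 (Subtype.ext e)
      field_simp
      -- goal: w l * u j = u l * w j, from `c w l = u l d`, `c w j = u j d`
      have := congrArg (· * ((u j : R') : K)) hgl
      have := congrArg (· * ((u l : R') : K)) hgj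
      apply mul_left_cancel₀ hc0
      apply mul_left_cancel₀ hd0K
      linear_combination (d : K) * (congrArg (· * ((u j : R') : K)) hgl) -
        (d : K) * (congrArg (· * ((u l : R') : K)) hgj)
    rw [e]
    exact R'.mul_mem (u l).2 hjinv

end Coords

/-! ## Removing the divisorial part -/

section Gcd

variable {R : Type*} [CommRing R] [IsDomain R] [IsNoetherianRing R] [IsLocalRing R]

/-- **Removing the greatest common divisor**: a non-zero ideal `J` of a Noetherian local domain
is `(g) · J₀` with `J₀` contained in no proper principal ideal (divide out non-unit common
divisors one at a time; the chain `J ⊊ (J : p) ⊊ ⋯` stops by Noetherianity, each step being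
proper by Nakayama). [folklore] -/
theorem exists_eq_span_singleton_mul_forall_not_le (J : Ideal R) (hJ : J ≠ ⊥) :
    ∃ (g : R) (J₀ : Ideal R), g ≠ 0 ∧ J = Ideal.span {g} * J₀ ∧
      ∀ p ∈ maximalIdeal R, ¬ J₀ ≤ Ideal.span {p} := by
  induction J using IsNoetherian.induction with
  | hgt J ih =>
    by_cases hex : ∃ p ∈ maximalIdeal R, J ≤ Ideal.span {p}
    · obtain ⟨p, hpm, hJp⟩ := hex
      have hp0 : p ≠ 0 := by
        rintro rfl
        apply hJ
        rwa [Ideal.span_singleton_eq_bot.mpr rfl, le_bot_iff] at hJp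
      set J' := J.colon {p} with hJ'
      have hJJ' : J = Ideal.span {p} * J' := eq_span_singleton_mul_colon hJp
      have hle : J ≤ J' := fun j hj =>
        Submodule.mem_colon_singleton.mpr (by rw [smul_eq_mul]; exact Ideal.mul_mem_right _ _ hj)
      have hne : J ≠ J' := by
        intro heq
        apply hJ
        refine Submodule.eq_bot_of_le_smul_of_le_jacobson_bot (maximalIdeal R) J
          (IsNoetherian.noetherian J) ?_ (maximalIdeal_le_jacobson _)
        calc J = Ideal.span {p} * J := by conv_lhs => rw [hJJ', ← heq]
          _ ≤ maximalIdeal R * J := Ideal.mul_mono_left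
              ((Ideal.span_singleton_le_iff_mem _).mpr hpm)
          _ = maximalIdeal R • J := rfl
      have hlt : J < J' := lt_of_le_of_ne hle hne
      have hJ'0 : J' ≠ ⊥ := fun h0 => hJ (le_bot_iff.mp (h0 ▸ hle))
      obtain ⟨g', J₀, hg'0, hJ'eq, hJ₀⟩ := ih J' hlt hJ'0
      refine ⟨p * g', J₀, mul_ne_zero hp0 hg'0, ?_, hJ₀⟩
      rw [hJJ', hJ'eq, ← mul_assoc, Ideal.span_singleton_mul_span_singleton]
    · push Not at hex
      exact ⟨1, J, one_ne_zero, by rw [Ideal.span_singleton_one, Ideal.top_mul], hex⟩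

end Gcd

/-- **An ideal of a two-dimensional regular local ring contained in no proper principal ideal is
`𝔪`-primary (or the unit ideal)**: every prime over it is `𝔪`, the other primes being principal
(`exists_eq_span_singleton_of_ne_maximalIdeal`). [cite: Matsumura1987, Thm. 20.3 (dimension two)] -/
theorem isFiniteLength_quotient_of_forall_not_le {R : Type*} [CommRing R] [IsRegularLocalRing R]
    (hdim : ringKrullDim R = 2) {J₀ : Ideal R} (h : ∀ p ∈ maximalIdeal R, ¬ J₀ ≤ Ideal.span {p}) :
    IsFiniteLength R (R ⧸ J₀) := by
  by_cases htop : J₀ = ⊤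
  · subst htop
    haveI : Subsingleton (R ⧸ (⊤ : Ideal R)) := Ideal.Quotient.subsingleton_iff.mpr rfl
    exact IsFiniteLength.of_subsingleton
  have hrad : maximalIdeal R ≤ J₀.radical := by
    rw [Ideal.radical_eq_sInf]
    refine le_sInf ?_
    rintro P ⟨hJP, hP⟩
    haveI := hP
    by_contra hmP
    have hPm : P ≠ maximalIdeal R := fun e => hmP e.ge
    obtain ⟨p, rfl⟩ := exists_eq_span_singleton_of_ne_maximalIdeal hdim P hPm
    exact h p (le_maximalIdeal hP.ne_top (Ideal.mem_span_singleton_self p)) hJP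
  obtain ⟨N, hN⟩ := Ideal.exists_pow_le_of_le_radical_of_fg hrad (IsNoetherian.noetherian _)
  exact Matsumura1987.isFiniteLength_quotient_of_pow_le hN

/-! ## Generic chart parameters at a bad quadratic transform -/

section Generic

variable {R : Subring K} [IsRegularLocalRing R]

/-- **A good chart parameter exists at each quadratic transform** when the residue field is
infinite: for `𝔪 = (u, v)`, `f` of order exactly `r`, and a quadratic transform `R₁` of `R`, some
`x = u + tv` has both `R[𝔪/x] ⊆ R₁` and `f ∉ (x) + 𝔪^{r+1}` — among `r + 2` pairwise incongruent
values of `t`, at most `r` fail the second condition (`card_le_of_forall_mem_span_sup_pow`) and at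
most one fails the first (`IsQuadraticTransform.sub_mem_maximalIdeal_of_not_le`).
[cite: ZariskiSamuel1960, Appendix 5] -/
theorem exists_good_chart (hdim : ringKrullDim R = 2) [Infinite (ResidueField R)] {u v : R}
    (huv : maximalIdeal R = Ideal.span {u, v}) {r : ℕ} (hr : 1 ≤ r) {f : R}
    (hfr : f ∈ maximalIdeal R ^ r) (hf : f ∉ maximalIdeal R ^ (r + 1))
    {R₁ : Subring K} [IsLocalRing R₁] (h₁ : IsQuadraticTransform R R₁) :
    ∃ t : R, blowupRing R ((u + t * v : R) : K) ≤ R₁ ∧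
      f ∉ Ideal.span {u + t * v} ⊔ maximalIdeal R ^ (r + 1) := by
  classical
  have hm := maximalIdeal_ne_span_singleton hdim
  -- `r + 2` pairwise incongruent elements of `R`
  obtain ⟨S, hS⟩ := Infinite.exists_subset_card_eq (ResidueField R) (r + 2)
  let lift : ResidueField R → R := Function.surjInv residue_surjective
  have hlift : ∀ s, residue R (lift s) = s := Function.surjInv_eq residue_surjective
  let T : Finset R := S.image lift
  have hinj : Set.InjOn lift S := fun s _ s' _ h => by rw [← hlift s, ← hlift s', h]
  have hTcard : T.card = r + 2 := by rw [Finset.card_image_of_injOn hinj, hS]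
  have hT : ∀ t ∈ T, ∀ t' ∈ T, t ≠ t' → t - t' ∉ maximalIdeal R := by
    intro t ht t' ht' hne hsub
    obtain ⟨s, hs, rfl⟩ := Finset.mem_image.mp ht
    obtain ⟨s', hs', rfl⟩ := Finset.mem_image.mp ht'
    apply hne
    have : residue R (lift s) = residue R (lift s') := by
      rw [← sub_eq_zero, ← map_sub, IsLocalRing.residue_eq_zero_iff]; exact hsub
    rw [hlift, hlift] at this
    rw [this]
  -- the two exceptional subsets
  let Ta := T.filter fun t => f ∈ Ideal.span {u + t * v} ⊔ maximalIdeal R ^ (r + 1)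
  let Tb := T.filter fun t => ¬ blowupRing R ((u + t * v : R) : K) ≤ R₁
  have hTa : Ta.card ≤ r :=
    card_le_of_forall_mem_span_sup_pow hdim huv hr hfr hf Ta
      (fun t ht t' ht' hne => hT t (Finset.mem_filter.mp ht).1 t' (Finset.mem_filter.mp ht').1 hne)
      (fun t ht => (Finset.mem_filter.mp ht).2)
  have hTb : Tb.card ≤ 1 := by
    refine Finset.card_le_one.mpr fun t ht t' ht' => ?_
    by_contra hne
    exact hT t (Finset.mem_filter.mp ht).1 t' (Finset.mem_filter.mp ht').1 hne
      (h₁.sub_mem_maximalIdeal_of_not_le huv hm (Finset.mem_filter.mp ht).2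
        (Finset.mem_filter.mp ht').2)
  -- a good `t`
  have hnot : ¬ T ⊆ Ta ∪ Tb := fun hsub => by
    have := (Finset.card_le_card hsub).trans (Finset.card_union_le _ _)
    omega
  obtain ⟨t, htT, ht⟩ := Finset.not_subset.mp hnot
  rw [Finset.mem_union, not_or] at ht
  refine ⟨t, ?_, fun hbad => ht.1 (Finset.mem_filter.mpr ⟨htT, hbad⟩)⟩
  by_contra hle
  exact ht.2 (Finset.mem_filter.mpr ⟨htT, hle⟩)

end Generic

/-! ## Bookkeeping for the induction -/

section Lemmas

variable {R : Subring K}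

/-- A Noetherian local subring of `K` which is a valuation ring of `K` is a principal ideal ring;
in particular all its ideals are principal. [folklore] -/
theorem isPrincipal_of_forall_mem_or_inv_mem {T : Subring K} [IsNoetherianRing T] [IsLocalRing T]
    (h : ∀ z : K, z ∈ T ∨ z⁻¹ ∈ T) (I : Ideal T) : I.IsPrincipal := by
  haveI : ValuationRing T := by
    refine { cond' := fun a b => ?_ }
    rcases h ((a : K) / b) with hz | hz
    · by_cases hb : (b : K) = 0
      · exact ⟨0, Or.inl (Subtype.ext (by simp [hb]))⟩
      · refine ⟨⟨_, hz⟩, Or.inr (Subtype.ext ?_)⟩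
        change (b : K) * (a / b) = a
        field_simp
    · by_cases ha : (a : K) = 0
      · exact ⟨0, Or.inr (Subtype.ext (by simp [ha]))⟩
      · refine ⟨⟨_, hz⟩, Or.inl (Subtype.ext ?_)⟩
        change (a : K) * ((a : K) / b)⁻¹ = b
        by_cases hb : (b : K) = 0
        · simp [hb]
        · field_simp
  haveI : IsPrincipalIdealRing T :=
    ((tfae_of_isNoetherianRing_of_isLocalRing_of_isDomain T).out 0 1).mpr ‹_›
  exact IsPrincipalIdealRing.principal I

/-- The residue field grows along a dominant inclusion of local subrings: an infinite residue
field downstairs gives an infinite one upstairs. [folklore] -/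
theorem infinite_residueField_of_subringDominates {S : Subring K} [IsLocalRing R] [IsLocalRing S]
    (h : SubringDominates R S) [Infinite (ResidueField R)] : Infinite (ResidueField S) := by
  haveI : IsLocalHom (Subring.inclusion h.1) := ⟨fun a ha => by
    rw [isUnit_subring_iff_inv_mem] at ha ⊢
    rw [Subring.coe_inclusion] at ha
    exact ⟨ha.1, h.2 _ a.2 ha.2⟩⟩
  exact Infinite.of_injective (ResidueField.map (Subring.inclusion h.1)) (RingHom.injective _)

/-- `extIdeal` of a principal extension is principal: principality of `J R₁` persists to
`R' ⊇ R₁`. [folklore] -/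
theorem isPrincipal_extIdeal_of_le {J : Ideal R} {R₁ R' : Subring K} (h : R ≤ R₁) (h' : R₁ ≤ R')
    (hp : (extIdeal J R₁).IsPrincipal) : (extIdeal J R').IsPrincipal := by
  rw [← map_extIdeal J h h']
  obtain ⟨g, hg⟩ := hp
  refine ⟨⟨Subring.inclusion h' g, ?_⟩⟩
  rw [hg, Ideal.submodule_span_eq, Ideal.map_span, Set.image_singleton, Ideal.submodule_span_eq]

end Lemmas

/-! ## The base tree of an ideal, and its finiteness -/

/-- The iterated quadratic transforms of `R` in which the ideal `J` of `R` does not become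
principal. [cite: ZariskiSamuel1960, Appendix 5] -/
def idealBaseTree (R : Subring K) (J : Ideal R) : Set (Subring K) :=
  {S | Relation.ReflTransGen IsQuadraticTransform R S ∧ ¬ (extIdeal J S).IsPrincipal}

/-- **Finiteness of the base tree of an `𝔪`-primary ideal** (Zariski–Samuel II, App. 5: an ideal
of a two-dimensional regular local ring becomes principal after finitely many point blowing ups,
at all points; Huneke–Swanson Lemma 14.3.4 for the count): for a two-dimensional regular local
ring `R` of `K = Frac R` with infinite residue field and an ideal `J ≠ 0` of finite colength, only
finitely many iterated quadratic transforms of `R` fail to principalize `J`. Induction on the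
colength `λ(R/J)`. [cite: ZariskiSamuel1960, Appendix 5] -/
theorem finite_idealBaseTree : ∀ (ℓ : ℕ) (R : Subring K) [IsRegularLocalRing R],
    ringKrullDim R = 2 → IsLocalRingOf R → Infinite (ResidueField R) →
    ∀ J : Ideal R, J ≠ ⊥ → IsFiniteLength R (R ⧸ J) → Module.length R (R ⧸ J) ≤ ℓ →
    (idealBaseTree R J).Finite := by
  intro ℓ
  induction ℓ using Nat.strong_induction_on with
  | _ ℓ ih =>
  intro R _ hdim hRK hinf J hJ0 hfin hlen
  classical
  haveI := hinf
  haveI := isDomain_of_isRegularLocalRing R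
  -- `J = ⊤`: nothing to do
  by_cases hJtop : J = ⊤
  · subst hJtop
    refine Set.finite_empty.subset ?_
    rintro S ⟨hS, hbad⟩
    exact hbad (by
      rw [extIdeal_eq_map _ (subringDominates_of_reflTransGen hS).1, Ideal.map_top]
      exact ⟨⟨1, by simp⟩⟩)
  have hJm : J ≤ maximalIdeal R := le_maximalIdeal hJtop
  -- the order `r` of `J`
  have hex : ∃ k, ¬ J ≤ maximalIdeal R ^ (k + 1) := by
    by_contra hall
    push Not at hall
    apply hJ0
    rw [← le_bot_iff, ← Ideal.iInf_pow_eq_bot_of_isLocalRing (maximalIdeal R)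
      (maximalIdeal.isMaximal R).ne_top]
    refine le_iInf fun k => ?_
    cases k with
    | zero => simp
    | succ k => exact hall k
  set r := Nat.find hex with hrdef
  have hJr : ¬ J ≤ maximalIdeal R ^ (r + 1) := Nat.find_spec hex
  have hJ : J ≤ maximalIdeal R ^ r := by
    rcases Nat.eq_zero_or_pos r with h0 | hpos
    · rw [h0, pow_zero, Ideal.one_eq_top]; exact le_top
    · have := Nat.find_min hex (show r - 1 < r by omega)
      push Not at this
      rwa [show r - 1 + 1 = r by omega] at this
  have hr : 1 ≤ r := by
    by_contra hlt
    push Not at hlt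
    have h0 : r = 0 := by omega
    apply hJr
    rw [h0, zero_add, pow_one]; exact hJm
  obtain ⟨f, hfJ, hf⟩ := Set.not_subset.mp hJr
  have hfr : f ∈ maximalIdeal R ^ r := hJ hfJ
  -- a regular system of parameters
  obtain ⟨u, v, huv, hup, hvp, huv', hvu'⟩ := exists_maximalIdeal_eq_span_pair hdim
  have hu0 : u ≠ 0 := hup.ne_zero
  have hv0 : v ≠ 0 := hvp.ne_zero
  have hpq : ∀ t, u ∣ v * t → u ∣ t := fun t ht => (hup.dvd_or_dvd ht).resolve_left huv'
  have hqp : ∀ t, v ∣ u * t → v ∣ t := fun t ht => (hvp.dvd_or_dvd ht).resolve_left hvu'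
  have hm := maximalIdeal_ne_span_singleton hdim
  -- the finitely many bad first quadratic transforms
  set BAD₁ : Set (Subring K) :=
    {R₁ | IsQuadraticTransform R R₁ ∧ ¬ (extIdeal J R₁).IsPrincipal} with hBAD₁
  have hBADfin : BAD₁.Finite :=
    finite_setOf_isQuadraticTransform_not_isPrincipal hdim huv hu0 hv0 hpq hqp hJ hJr
  -- above each bad `R₁`, the bad iterated transforms form a finite set (induction hypothesis)
  have key : ∀ R₁ ∈ BAD₁, ∃ S : Set (Subring K), S.Finite ∧ ∀ R', Relation.ReflTransGen
      IsQuadraticTransform R₁ R' → ¬ (extIdeal J R').IsPrincipal → R' ∈ S := by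
    rintro R₁ ⟨h₁, hbad⟩
    haveI := h₁.isLocalRing
    have hdom := h₁.dominates
    -- a good chart parameter `x = u + t v` and the chart `A = R[y/x] ⊆ R₁ = A_Q`
    obtain ⟨t, hchart, hgood⟩ := exists_good_chart hdim huv hr hfr hf h₁
    have hx2 : u + t * v ∉ maximalIdeal R ^ 2 := add_mul_not_mem_sq hdim huv t
    have hx0 : u + t * v ≠ 0 := fun h0 => hx2 (h0 ▸ Submodule.zero_mem _)
    have hxm : u + t * v ∈ maximalIdeal R := by
      rw [huv]
      exact Ideal.add_mem _ (Ideal.subset_span (by simp))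
        (Ideal.mul_mem_left _ _ (Ideal.subset_span (by simp)))
    obtain ⟨y, hm', hxp, hxy⟩ := exists_maximalIdeal_eq_span_pair_of_not_mem_sq hdim hxm hx2
    set x : R := u + t * v with hxdef
    set A : Subring K := chartAdjoin (K := K) x y with hAdef
    have hAeq : blowupRing R (x : K) = A := blowupRing_eq_adjoin hm'
    have hle : A ≤ R₁ := hAeq.symm.le.trans hchart
    set Q : Ideal A := (maximalIdeal R₁).comap (Subring.inclusion hle) with hQdef
    set L : Subring K := (LocalSubring.ofPrime A Q).toSubring with hLdef
    have hR₁L : R₁ = L := h₁.eq_ofPrime_of_le hxm hx0 hAeq.le hle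
    -- the weak transform `J₁` on `L` and the colength drop
    set J₁ : Ideal L := (weakTransformChart x y J r).map (algebraMap A L) with hJ₁def
    have hlt : Module.length L (L ⧸ J₁) < Module.length R (R ⧸ J) :=
      length_quotient_weakTransform_map_lt hdim hm' hx0 hr hJ hfJ hgood hfin Q
    have hltℓ : Module.length L (L ⧸ J₁) < (ℓ : ℕ∞) := hlt.trans_le hlen
    have hne : Module.length L (L ⧸ J₁) ≠ ⊤ := ne_top_of_lt hltℓ
    have hfin₁ : IsFiniteLength L (L ⧸ J₁) := Module.length_ne_top_iff.mp hne
    obtain ⟨ℓ₁, hℓ₁⟩ := ENat.ne_top_iff_exists.mp hne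
    have hℓ₁lt : ℓ₁ < ℓ := by
      rw [← hℓ₁] at hltℓ
      exact_mod_cast hltℓ
    -- `L` is again a two-dimensional regular local ring of `K` with infinite residue field
    haveI : IsNoetherianRing A := isNoetherianRing_adjoin_toSubring R _
    haveI : IsNoetherianRing L := isNoetherianRing_ofPrime (A := A) (P := Q)
    have hregdim : IsRegularLocalRing L ∧ ringKrullDim L = 2 := by
      rcases h₁.mem_or_inv_mem_or_isRegularLocalRing hdim hRK with hval | hreg
      · exfalso
        apply hbad
        rw [hR₁L]
        exact isPrincipal_of_forall_mem_or_inv_mem (by rw [← hR₁L]; exact hval) _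
      · rw [← hR₁L]; exact hreg
    haveI := hregdim.1
    have hRK₁ : IsLocalRingOf L := isLocalRingOf_of_le hRK ((subring_le_adjoin R _).trans
      (LocalSubring.le_ofPrime A Q))
    have hinf₁ : Infinite (ResidueField L) :=
      infinite_residueField_of_subringDominates (hR₁L ▸ hdom)
    -- `J₁ ≠ ⊥`
    have hJ₁0 : J₁ ≠ ⊥ := by
      intro h0
      have hW0 : weakTransformChart (K := K) x y J r = ⊥ := by
        rw [hJ₁def, Ideal.map_eq_bot_iff_of_injective] at h0
        · exact h0
        · exact fun a b hab => Subtype.ext (congrArg (fun z : L => (z : K)) hab)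
      apply hJ0
      have hJA : J.map (chartIncl (K := K) x y) = ⊥ := by
        rw [map_eq_span_pow_mul_weakTransform hm' hx0 hJ, hW0, Ideal.mul_bot]
      rw [Ideal.map_eq_bot_iff_of_injective (chartIncl_injective x y)] at hJA
      exact hJA
    -- the induction hypothesis above `L`
    have hIH := ih ℓ₁ hℓ₁lt L hregdim.2 hRK₁ hinf₁ J₁ hJ₁0 hfin₁ hℓ₁.symm.le
    refine ⟨idealBaseTree L J₁, hIH, fun R' hR' hbad' => ⟨hR₁L ▸ hR', fun hp => hbad' ?_⟩⟩
    -- principality of `J₁ R'` gives principality of `J R'`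
    haveI : IsLocalRing R' := isLocalRing_of_reflTransGen hR'
    have h₁' : R₁ ≤ R' := (subringDominates_of_reflTransGen hR').1
    have hA' : A ≤ R' := hle.trans h₁'
    rw [isPrincipal_extIdeal_iff hm' hx0 hJ hA']
    have hLR' : L ≤ R' := hR₁L ▸ h₁'
    have e : extIdeal J₁ R' = (weakTransformChart (K := K) x y J r).map (Subring.inclusion hA') := by
      rw [extIdeal_eq_map J₁ hLR', hJ₁def, Ideal.map_map]
      rfl
    rwa [e] at hp
  choose S hSfin hS using key
  -- assembling
  refine ((Set.finite_singleton R).union (hBADfin.biUnion' fun R₁ hR₁ => hSfin R₁ hR₁)).subset ?_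
  rintro R' ⟨hR', hbad'⟩
  rcases reflTransGen_iff_eq_or_exists_head.mp hR' with rfl | ⟨R₁, h₁, h₂⟩
  · exact Or.inl rfl
  · right
    have hR₁bad : R₁ ∈ BAD₁ := by
      refine ⟨h₁, fun hp => hbad' ?_⟩
      haveI := h₁.isLocalRing
      exact isPrincipal_extIdeal_of_le h₁.dominates.1 (subringDominates_of_reflTransGen h₂).1 hp
    exact Set.mem_iUnion.mpr ⟨R₁, Set.mem_iUnion.mpr ⟨hR₁bad, hS R₁ hR₁bad R' h₂ hbad'⟩⟩

/-- **Finiteness of the base tree of a vector** (Zariski–Samuel II, App. 5; Zariski 1944): for a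
two-dimensional regular local ring `R` of `K = Frac R` with infinite residue field and a non-zero
`w ∈ Kⁿ⁺¹`, only finitely many iterated quadratic transforms of `R` are base points of
`(w₀ : … : wₙ)`. [cite: ZariskiSamuel1960, Appendix 5] -/
theorem finite_baseTree {R : Subring K} [IsRegularLocalRing R] (hdim : ringKrullDim R = 2)
    (hRK : IsLocalRingOf R) (hinf : Infinite (ResidueField R)) {n : ℕ} (w : Fin (n + 1) → K)
    (hw : ∃ i, w i ≠ 0) : (baseTree R w).Finite := by
  haveI := isDomain_of_isRegularLocalRing R
  obtain ⟨c, hc0, hc⟩ := exists_forall_mul_mem hRK w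
  set J := coordIdeal w c hc with hJdef
  -- `J ≠ ⊥`
  have hJ0 : J ≠ ⊥ := by
    obtain ⟨i, hi⟩ := hw
    intro h0
    have hmem : (⟨(c : K) * w i, hc i⟩ : R) ∈ J := Ideal.subset_span ⟨i, rfl⟩
    rw [h0, Ideal.mem_bot] at hmem
    exact (mul_ne_zero hc0 hi) (congrArg Subtype.val hmem)
  -- remove the divisorial part: `J = (g) J₀`
  obtain ⟨g, J₀, hg0, hJg, hJ₀⟩ := exists_eq_span_singleton_mul_forall_not_le J hJ0
  have hJ₀0 : J₀ ≠ ⊥ := by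
    intro h0; apply hJ0; rw [hJg, h0, Ideal.mul_bot]
  have hfin : IsFiniteLength R (R ⧸ J₀) := isFiniteLength_quotient_of_forall_not_le hdim hJ₀
  have hlen : Module.length R (R ⧸ J₀) ≠ ⊤ := Module.length_ne_top_iff.mpr hfin
  obtain ⟨ℓ, hℓ⟩ := ENat.ne_top_iff_exists.mp hlen
  refine (finite_idealBaseTree ℓ R hdim hRK hinf J₀ hJ₀0 hfin hℓ.symm.le).subset ?_
  rintro R' ⟨hR', hdef⟩
  haveI : IsLocalRing R' := isLocalRing_of_reflTransGen hR'
  have hRR' : R ≤ R' := (subringDominates_of_reflTransGen hR').1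
  refine ⟨hR', fun hp => hdef ?_⟩
  rw [definedOn_iff_isPrincipal_extIdeal w hw c hc0 hc hRR']
  -- `J R' = g · J₀ R'`
  have e : extIdeal J R' = Ideal.span {Subring.inclusion hRR' g} * extIdeal J₀ R' := by
    rw [extIdeal_eq_map _ hRR', extIdeal_eq_map _ hRR', hJg, Ideal.map_mul, Ideal.map_span,
      Set.image_singleton]
  rw [e]
  refine (isPrincipal_span_singleton_mul_iff ?_ _).mpr hp
  intro h0
  exact hg0 (Subtype.ext (congrArg (fun z : R' => (z : K)) h0))

end Literature.AlgebraicGeometry.Resolution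

end
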